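import Summits.ResolutionOfSingularities.ResolutionOfSingularities.Theorems.FrobeniusLadderFInjectiveMacaulayficationOmegaExitTag
import Summits.ResolutionOfSingularities.ResolutionOfSingularities.Theorems.FrobeniusLadderFInjectiveMacaulayficationPencilExitTagMaster
import HarnessLib

/-!
# TASK 4c — THE Ω₁ LOCAL CURE ROW (local model, chart level): on each of the three certified cure fans of ✓p694236 (Γ₉ = G9, Γ₁₀ = G10, `Q*` = G10Q), for EVERY cone chart, EVERY
# `k`-point of BOTH pencil charts of the blow-up of `𝒥·𝒪` is `FullCl p`, for every prime `p ≥ 5` and every field `k` of characteristic `p`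
# (crux `FInjectiveMacaulayfication` stmt-ResolutionOfSingularities-15315, chain w45a; res-L1-w45a-plan-1 RULINGS R23.8 «4c = list bridge + LOCAL assembly», R23.9 (2) «for the LOCAL
# row the chart-level statements suffice — say «local model» in the title», R23.14 (division of labour), acceptance numbers l.85815; seat res-L1-w45a-stub-3 g13; inputs: DATA
# ✓p694236 `OmegaOneCureFanCert` + ✓ `OmegaOneCureFanCertStrong` (res-L1-w45a-stub-1 g15), SOUNDNESS = stub-1ʼs per-code family through the MASTER theorems `PencilExitTagMaster`,
# BRIDGE ✓p702007 `OmegaExitBridge` + `OmegaExitTag`)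

[OURS · L1 W4.5a] Support file (`--supports stmt-ResolutionOfSingularities-15315 --as helper`); theorems only; no definitions, no named facts. What is proved is a statement about
EXPLICIT HYPERSURFACES over a field: NOT the census letter «Ω₁: ADMISSIBLE ∧ NOT FULL ∧ CURED» (whose CURED half needs the GLOBAL patch of these local fans into B9ʼs 25-chart fan —
not done, not claimed), NOT a statement of any manuscript, nothing of the crux. AI-written (AI review is weaker than expert review).

THE OBJECTS (✓p694236 docstring). A cone `σ` of the fan (rows `ρ₁..ρ_n = raysOf RAYS σ`) is the chart `U_σ = 𝔸ⁿ_y` of the toric modification `X_Σ → 𝔸ⁿ`; on it the marked ideal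
`𝒥 = (x_CI^e, x^P − x^Q)` pulls back to `y^G·(y^{M₁}, y^{M₂}(y^r − y^s))` with `C = e·ρ[CI]`, `A = ρ·P`, `B = ρ·Q`, `m = min(A,B)`, `G = min(C,m)`, `M₁ = C − G`, `M₂ = m − G`,
`r = A − m`, `s = B − m` (the `let`s below = the `let`s of `exitOK`); blowing up `(y^{M₁}, y^{M₂}(y^r − y^s))` gives the two pencil charts
`V(Φ_W) ⊂ 𝔸ⁿ⁺¹`, `Φ_W = (y^{M₁})⁺·W − (y^{M₂}(y^r − y^s))⁺`, and `V(Φ_U)`, `Φ_U = (y^{M₂}(y^r − y^s))⁺·U − (y^{M₁})⁺` (`q⁺ = rename Fin.succ q`, `W, U = X 0`).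
THE ROW: for every `σ ∈ CONES`, every `c : Fin n → k`, every `w₀` (resp. `u₀`) and every closed point `y` of `V(Φ_W)` (resp. `V(Φ_U)`) lying over `(w₀; c)` (resp. `(u₀; c)`):
`FullCl p 𝒪_{V(Φ),y}`. PROOF = ✓ `cert'_*` (data) → `exitOK'` at (σ, {c = 0}, tag) (§1 unpacking; the torus point `{c = 0} = ∅` takes tag 0 vacuously; `{c = 0} ∈ ORB` by
`hORB`) → ✓ `OmegaExitTag.tag_of_exitOK'` (bridge) → stub-1ʼs `fullCl_pencilChartW_of_tag` / `fullCl_pencilChartU_of_tag` (soundness, primality inside; data hypotheses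
`M₁ ⊥ M₂`, `r ⊥ s`, `r ≠ s` from ✓ `exitData_props` and the per-cone side condition `A ≠ B`, decided per fan). PRIME RANGE of the cured side: `5 ≤ p` (codes 1/3); the NOT-FULL
input side (✓p695677/✓p697878/✓p698385) is every prime.
* §1 generic: `exitOK'_of_checkExits'_getL`, ★ `tag_of_checkExits'`, ★★ `fullCl_pencilChartW_of_checkExits'`, ★★ `fullCl_pencilChartU_of_checkExits'`;
* §2 side conditions and census by code (`decide`): `orb3_complete`, `orb4_complete`, `sides_G9/G10/G10Q`, `census_G9/G10/G10Q` (= res-L1-w45a-tri-2ʼs independent counts l.85813: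
  G9 {0:48, 1:203, 2:4, 3:4} of 259 · G10 {0:82, 1:366, 2:7} of 455 · G10Q {0:229, 1:546, 2:13, 4:6, 5:181} of 975);
* §3 ★★★ THE ROW: `omega1_G9_pencilChartW_fullCl` / `…U_fullCl`, `omega1_G10_…`, `omega1_G10Q_…`.
[cite: Fedder1983, Thm. 1.12; CoxLittleSchenck2011, §2.3 (toric charts)]
-/

set_option linter.dupNamespace false

noncomputable section

open AlgebraicGeometry IsLocalRing MvPolynomial
open scoped Pointwise

namespace Summit.ResolutionOfSingularities.ResolutionOfSingularities.Theorems.FInjectiveMacaulayfication.OmegaLocalCureRow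

open Summit.ResolutionOfSingularities.ResolutionOfSingularities.Theorems.FInjectiveMacaulayfication
open FanCheckKit FanCheckSound OmegaOneCureFanCert OmegaOneCureFanCertStrong OmegaExitBridge OmegaExitTag SliceableCentre

/-! ## §1 Generic assembly over a certified fan -/

section Generic

variable {k : Type} [Field k]

/-- `checkExits'` unpacks to `exitOK'` at every (cone index, orbit index) with the tabulated tag. [plumbing] -/
theorem exitOK'_of_checkExits'_getL (n e CI : ℕ) (P Q : List ℕ) (RAYS CONES ORB TAGS : List (List ℕ)) (h : checkExits' n e CI P Q RAYS CONES ORB TAGS = true)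
    (j : ℕ) (hj : j < CONES.length) (m : ℕ) (hm : m < ORB.length) :
    exitOK' n e CI P Q (raysOf RAYS (getL CONES j [])) (getL ORB m []) (getL (getL TAGS j []) m 0) = true := by
  unfold checkExits' at h
  rw [Bool.and_eq_true, Nat.beq_eq] at h
  have h1 := all_zip_getL CONES TAGS [] [] _ h.2 j hj (h.1 ▸ hj)
  dsimp only at h1
  rw [Bool.and_eq_true, Nat.beq_eq] at h1
  exact all_zip_getL ORB (getL TAGS j []) [] 0 _ h1.2 m hm (h1.1 ▸ hm)

/-- ★ **THE TAG DISJUNCTION AT EVERY POINT OF EVERY CONE CHART of a fan passing `checkExits'`** (orbits listed by `ORB` ⊇ all non-empty coordinate patterns; the torus point takes tag 0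
vacuously). [OURS · TASK 4c] -/
theorem tag_of_checkExits' (n e CI : ℕ) (P Q : List ℕ) (RAYS CONES ORB TAGS : List (List ℕ)) (hchk : checkExits' n e CI P Q RAYS CONES ORB TAGS = true)
    (hORB : ∀ Z ∈ (List.range n).sublists, Z ≠ [] → Z ∈ ORB) (σ : List ℕ) (hσ : σ ∈ CONES) (M₁ M₂ r s : Fin n →₀ ℕ)
    (hM₁ : ∀ i : Fin n, M₁ i = getL (vsub ((raysOf RAYS σ).map fun ρ => e * getL ρ CI 0) (vmin ((raysOf RAYS σ).map fun ρ => e * getL ρ CI 0)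
      (vmin ((raysOf RAYS σ).map fun ρ => dotL ρ P) ((raysOf RAYS σ).map fun ρ => dotL ρ Q)))) i 0)
    (hM₂ : ∀ i : Fin n, M₂ i = getL (vsub (vmin ((raysOf RAYS σ).map fun ρ => dotL ρ P) ((raysOf RAYS σ).map fun ρ => dotL ρ Q))
      (vmin ((raysOf RAYS σ).map fun ρ => e * getL ρ CI 0) (vmin ((raysOf RAYS σ).map fun ρ => dotL ρ P) ((raysOf RAYS σ).map fun ρ => dotL ρ Q)))) i 0)
    (hr : ∀ i : Fin n, r i = getL (vsub ((raysOf RAYS σ).map fun ρ => dotL ρ P) (vmin ((raysOf RAYS σ).map fun ρ => dotL ρ P) ((raysOf RAYS σ).map fun ρ => dotL ρ Q))) i 0)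
    (hs : ∀ i : Fin n, s i = getL (vsub ((raysOf RAYS σ).map fun ρ => dotL ρ Q) (vmin ((raysOf RAYS σ).map fun ρ => dotL ρ P) ((raysOf RAYS σ).map fun ρ => dotL ρ Q))) i 0)
    (c : Fin n → k) :
    (∀ i, c i = 0 → M₁ i = 0) ∨
      (¬ ((∃ i, c i = 0 ∧ r i ≠ 0) ∧ (∃ i, c i = 0 ∧ s i ≠ 0)) ∧
        ((∃ i, c i = 0 ∧ r i ≠ 0) ∨ (∃ i, c i = 0 ∧ s i ≠ 0) ∨ (∃ i, c i ≠ 0 ∧ 1 ≤ (r i - s i) + (s i - r i) ∧ (r i - s i) + (s i - r i) ≤ 4)) ∧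
        (∀ i, c i = 0 → M₂ i ≤ 1)) ∨
      (¬ ((∃ i, c i = 0 ∧ r i ≠ 0) ∧ (∃ i, c i = 0 ∧ s i ≠ 0)) ∧
        ((∃ i, c i = 0 ∧ r i ≠ 0) ∨ (∃ i, c i = 0 ∧ s i ≠ 0) ∨ (∃ i, c i ≠ 0 ∧ 1 ≤ (r i - s i) + (s i - r i) ∧ (r i - s i) + (s i - r i) ≤ 4)) ∧
        (∀ i, c i = 0 → M₁ i ≤ 1)) ∨
      (¬ ((∃ i, c i = 0 ∧ r i ≠ 0) ∧ (∃ i, c i = 0 ∧ s i ≠ 0)) ∧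
        ((∃ i, c i = 0 ∧ r i ≠ 0) ∨ (∃ i, c i = 0 ∧ s i ≠ 0) ∨ (∃ i, c i ≠ 0 ∧ 1 ≤ (r i - s i) + (s i - r i) ∧ (r i - s i) + (s i - r i) ≤ 4)) ∧
        (∀ i, c i = 0 → M₁ i ≤ 2) ∧ (∀ i, c i = 0 → M₂ i ≤ 2)) ∨
      (((∃ i, c i = 0 ∧ r i ≠ 0) ∧ (∃ i, c i = 0 ∧ s i ≠ 0)) ∧ (∀ i, c i = 0 → M₁ i ≤ 1)) ∨
      (((∃ i, c i = 0 ∧ r i ≠ 0) ∧ (∃ i, c i = 0 ∧ s i ≠ 0)) ∧ (∀ i, c i = 0 → M₂ i + r i ≤ 1) ∧ (∃ i, c i = 0 ∧ M₁ i ≠ 0 ∧ r i = 0)) ∨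
      (((∃ i, c i = 0 ∧ r i ≠ 0) ∧ (∃ i, c i = 0 ∧ s i ≠ 0)) ∧ (∀ i, c i = 0 → M₂ i + s i ≤ 1) ∧ (∃ i, c i = 0 ∧ M₁ i ≠ 0 ∧ s i = 0)) ∨
      (((∃ i, c i = 0 ∧ r i ≠ 0) ∧ (∃ i, c i = 0 ∧ s i ≠ 0)) ∧ (∀ i, c i = 0 → M₁ i + M₂ i + r i ≤ 2)) ∨
      (((∃ i, c i = 0 ∧ r i ≠ 0) ∧ (∃ i, c i = 0 ∧ s i ≠ 0)) ∧ (∀ i, c i = 0 → M₁ i + M₂ i + s i ≤ 2)) := by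
  classical
  obtain ⟨j, hj, hjσ⟩ := exists_getL_eq_of_mem CONES [] hσ
  -- the orbit of `c` as a list of letters
  set Z : List ℕ := (List.range n).filter fun j => decide (∃ h : j < n, c ⟨j, h⟩ = 0) with hZdef
  have hZ : ∀ i : Fin n, c i = 0 ↔ (i : ℕ) ∈ Z := fun i => by
    rw [hZdef, List.mem_filter, List.mem_range, decide_eq_true_iff]
    exact ⟨fun h => ⟨i.2, i.2, h⟩, fun ⟨_, _, h⟩ => h⟩
  have hZn : ∀ j ∈ Z, j < n := fun j hj => by
    rw [hZdef, List.mem_filter, List.mem_range] at hj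
    exact hj.1
  by_cases hZe : Z = []
  · exact Or.inl fun i hci => absurd ((hZ i).1 hci) (by rw [hZe]; exact List.not_mem_nil)
  · have hZO : Z ∈ ORB := hORB Z (List.mem_sublists.2 List.filter_sublist) hZe
    obtain ⟨m, hm, hmZ⟩ := exists_getL_eq_of_mem ORB [] hZO
    have hok := exitOK'_of_checkExits'_getL n e CI P Q RAYS CONES ORB TAGS hchk j hj m hm
    rw [hjσ, hmZ] at hok
    exact tag_of_exitOK' e CI P Q (raysOf RAYS σ) Z _ hok M₁ M₂ r s hM₁ hM₂ hr hs c hZ hZn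

variable (k)

/-- ★★ **`W`-CHARTS FULL ON A CERTIFIED FAN**: if a fan passes ✓ `checkExits'`, its orbit list covers all non-empty coordinate patterns, its cones have `n` rays and on every cone
the two weight columns differ, then for every cone `σ`, every `c`, every `w₀` and every closed point `y` of `V(Φ_W(σ))` over `(w₀; c)`: `FullCl p 𝒪_{V(Φ_W(σ)), y}` (`p ≥ 5`).
[OURS · TASK 4c local assembly; cite: Fedder1983, Thm. 1.12] -/
theorem fullCl_pencilChartW_of_checkExits' (p : ℕ) [Fact p.Prime] [CharP k p] (hp5 : 5 ≤ p) (n e CI : ℕ) (P Q : List ℕ) (RAYS CONES ORB TAGS : List (List ℕ))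
    (hchk : checkExits' n e CI P Q RAYS CONES ORB TAGS = true) (hORB : ∀ Z ∈ (List.range n).sublists, Z ≠ [] → Z ∈ ORB) (hlen : ∀ σ ∈ CONES, σ.length = n)
    (hAB : ∀ σ ∈ CONES, ((raysOf RAYS σ).map fun ρ => dotL ρ P) ≠ ((raysOf RAYS σ).map fun ρ => dotL ρ Q)) (σ : List ℕ) (hσ : σ ∈ CONES) :
    let rows := raysOf RAYS σ
    let Cv := rows.map fun ρ => e * getL ρ CI 0
    let Av := rows.map fun ρ => dotL ρ P
    let Bv := rows.map fun ρ => dotL ρ Q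
    let mv := vmin Av Bv
    let Gv := vmin Cv mv
    let M₁ := expOf n (vsub Cv Gv)
    let M₂ := expOf n (vsub mv Gv)
    let r := expOf n (vsub Av mv)
    let s := expOf n (vsub Bv mv)
    let Φ : MvPolynomial (Fin (n + 1)) k := rename Fin.succ (monomial M₁ (1 : k)) * X 0 - rename Fin.succ (monomial M₂ (1 : k) * (monomial r 1 - monomial s 1))
    ∀ (c : Fin n → k) (w₀ : k) (y : Spec (.of (MvPolynomial (Fin (n + 1)) k ⧸ Ideal.span {Φ}))), y.asIdeal.IsMaximal →
      y.asIdeal.comap (Ideal.Quotient.mk (Ideal.span {Φ})) = Ideal.span (Set.range (Fin.cons ((X 0 : MvPolynomial (Fin (n + 1)) k) - C w₀) fun i : Fin n => X i.succ - C (c i))) →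
      FullCl p ((Spec (.of (MvPolynomial (Fin (n + 1)) k ⧸ Ideal.span {Φ}))).presheaf.stalk y) := by
  intro rows Cv Av Bv mv Gv M₁ M₂ r s Φ c w₀ y hy ha
  have hn : rows.length = n := (length_raysOf RAYS σ).trans (hlen σ hσ)
  obtain ⟨hdisj, hrs, hne⟩ := exitData_props e CI P Q rows hn (hAB σ hσ) M₁ M₂ r s (fun i => expOf_apply' n _ i) (fun i => expOf_apply' n _ i)
    (fun i => expOf_apply' n _ i) (fun i => expOf_apply' n _ i)
  exact PencilExitTagMaster.fullCl_pencilChartW_of_tag k p hp5 M₁ M₂ r s hdisj hrs hne Φ rfl c w₀ y hy ha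
    (tag_of_checkExits' n e CI P Q RAYS CONES ORB TAGS hchk hORB σ hσ M₁ M₂ r s (fun i => expOf_apply' n _ i) (fun i => expOf_apply' n _ i)
      (fun i => expOf_apply' n _ i) (fun i => expOf_apply' n _ i) c)

/-- ★★ **`U`-CHARTS FULL ON A CERTIFIED FAN** (every `u₀`: the pole by the pole family, `u₀ ≠ 0` by the chart-gluing transfer ✓p701234, both inside stub-1ʼs `fullCl_pencilChartU_of_tag`).
[OURS · TASK 4c local assembly; cite: Fedder1983, Thm. 1.12] -/
theorem fullCl_pencilChartU_of_checkExits' (p : ℕ) [Fact p.Prime] [CharP k p] (hp5 : 5 ≤ p) (n e CI : ℕ) (P Q : List ℕ) (RAYS CONES ORB TAGS : List (List ℕ))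
    (hchk : checkExits' n e CI P Q RAYS CONES ORB TAGS = true) (hORB : ∀ Z ∈ (List.range n).sublists, Z ≠ [] → Z ∈ ORB) (hlen : ∀ σ ∈ CONES, σ.length = n)
    (hAB : ∀ σ ∈ CONES, ((raysOf RAYS σ).map fun ρ => dotL ρ P) ≠ ((raysOf RAYS σ).map fun ρ => dotL ρ Q)) (σ : List ℕ) (hσ : σ ∈ CONES) :
    let rows := raysOf RAYS σ
    let Cv := rows.map fun ρ => e * getL ρ CI 0
    let Av := rows.map fun ρ => dotL ρ P
    let Bv := rows.map fun ρ => dotL ρ Q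
    let mv := vmin Av Bv
    let Gv := vmin Cv mv
    let M₁ := expOf n (vsub Cv Gv)
    let M₂ := expOf n (vsub mv Gv)
    let r := expOf n (vsub Av mv)
    let s := expOf n (vsub Bv mv)
    let Φ : MvPolynomial (Fin (n + 1)) k := rename Fin.succ (monomial M₂ (1 : k) * (monomial r 1 - monomial s 1)) * X 0 - rename Fin.succ (monomial M₁ (1 : k))
    ∀ (c : Fin n → k) (u₀ : k) (y : Spec (.of (MvPolynomial (Fin (n + 1)) k ⧸ Ideal.span {Φ}))), y.asIdeal.IsMaximal →
      y.asIdeal.comap (Ideal.Quotient.mk (Ideal.span {Φ})) = Ideal.span (Set.range (Fin.cons ((X 0 : MvPolynomial (Fin (n + 1)) k) - C u₀) fun i : Fin n => X i.succ - C (c i))) →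
      FullCl p ((Spec (.of (MvPolynomial (Fin (n + 1)) k ⧸ Ideal.span {Φ}))).presheaf.stalk y) := by
  intro rows Cv Av Bv mv Gv M₁ M₂ r s Φ c u₀ y hy ha
  have hn : rows.length = n := (length_raysOf RAYS σ).trans (hlen σ hσ)
  obtain ⟨hdisj, hrs, hne⟩ := exitData_props e CI P Q rows hn (hAB σ hσ) M₁ M₂ r s (fun i => expOf_apply' n _ i) (fun i => expOf_apply' n _ i)
    (fun i => expOf_apply' n _ i) (fun i => expOf_apply' n _ i)
  exact PencilExitTagMaster.fullCl_pencilChartU_of_tag k p hp5 M₁ M₂ r s hdisj hrs hne Φ rfl c u₀ y hy ha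
    (tag_of_checkExits' n e CI P Q RAYS CONES ORB TAGS hchk hORB σ hσ M₁ M₂ r s (fun i => expOf_apply' n _ i) (fun i => expOf_apply' n _ i)
      (fun i => expOf_apply' n _ i) (fun i => expOf_apply' n _ i) c)

end Generic

/-! ## §2 The side conditions of the three fans and the census by code (`decide`) -/

/-- `ORB3` lists every non-empty coordinate pattern of three letters. [bookkeeping] -/
theorem orb3_complete : ∀ Z ∈ (List.range 3).sublists, Z ≠ [] → Z ∈ ORB3 := by decide

/-- `ORB4` lists every non-empty coordinate pattern of four letters. [bookkeeping] -/
theorem orb4_complete : ∀ Z ∈ (List.range 4).sublists, Z ≠ [] → Z ∈ ORB4 := by decide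

/-- G9: every cone has 3 rays and distinct weight columns `A ≠ B`. [bookkeeping] -/
theorem sides_G9 : (∀ σ ∈ CONES_G9, σ.length = 3) ∧
    ∀ σ ∈ CONES_G9, ((raysOf RAYS_G9 σ).map fun ρ => dotL ρ [2, 0, 0]) ≠ ((raysOf RAYS_G9 σ).map fun ρ => dotL ρ [0, 3, 0]) := by decide

/-- G10: every cone has 3 rays and distinct weight columns. [bookkeeping] -/
theorem sides_G10 : (∀ σ ∈ CONES_G10, σ.length = 3) ∧
    ∀ σ ∈ CONES_G10, ((raysOf RAYS_G10 σ).map fun ρ => dotL ρ [2, 0, 0]) ≠ ((raysOf RAYS_G10 σ).map fun ρ => dotL ρ [0, 3, 0]) := by decide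

/-- G10Q: every cone has 4 rays and distinct weight columns. [bookkeeping] -/
theorem sides_G10Q : (∀ σ ∈ CONES_G10Q, σ.length = 4) ∧
    ∀ σ ∈ CONES_G10Q, ((raysOf RAYS_G10Q σ).map fun ρ => dotL ρ [1, 2, 0, 0]) ≠ ((raysOf RAYS_G10Q σ).map fun ρ => dotL ρ [0, 0, 3, 0]) := by decide

/-- **CENSUS BY CODE, G9** (acceptance numbers of res-L1-w45a-tri-2 l.85813): 259 (cone, orbit) pairs = 48 code 0 + 203 code 1 + 4 code 2 + 4 code 3, nothing else. [bookkeeping] -/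
theorem census_G9 : TAGS_G9.flatten.length = 259 ∧ ((List.range 9).map fun t => TAGS_G9.flatten.count t) = [48, 203, 4, 4, 0, 0, 0, 0, 0] := by
  decide +kernel

/-- **CENSUS BY CODE, G10**: 455 pairs = 82 code 0 + 366 code 1 + 7 code 2. [bookkeeping] -/
theorem census_G10 : TAGS_G10.flatten.length = 455 ∧ ((List.range 9).map fun t => TAGS_G10.flatten.count t) = [82, 366, 7, 0, 0, 0, 0, 0, 0] := by
  decide +kernel

/-- **CENSUS BY CODE, G10Q**: 975 pairs = 229 code 0 + 546 code 1 + 13 code 2 + 6 code 4 + 181 code 5. [bookkeeping] -/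
theorem census_G10Q : TAGS_G10Q.flatten.length = 975 ∧ ((List.range 9).map fun t => TAGS_G10Q.flatten.count t) = [229, 546, 13, 0, 6, 181, 0, 0, 0] := by
  decide +kernel

/-! ## §3 ★★★ THE LOCAL ROW on the three fans -/

section Row

variable (k : Type) [Field k] (p : ℕ) [Fact p.Prime] [CharP k p]

/-- ★★★ **Ω₁ LOCAL CURE ROW, Γ₉ (G9: `𝒥 = (c²², a² − b³)` on `k[a,b,c]`, 21 rays / 37 cones), `W`-CHARTS**: for every cone `σ` of the cure fan, every point `c` of the chart `U_σ`, every
`w₀` and every closed point `y` of the `W`-pencil chart over `(w₀; c)`: `FullCl p 𝒪_y`, `p ≥ 5`. [OURS · TASK 4c; cite: Fedder1983, Thm. 1.12] -/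
theorem omega1_G9_pencilChartW_fullCl (hp5 : 5 ≤ p) (σ : List ℕ) (hσ : σ ∈ CONES_G9) :
    let rows := raysOf RAYS_G9 σ
    let Cv := rows.map fun ρ => 22 * getL ρ 2 0
    let Av := rows.map fun ρ => dotL ρ [2, 0, 0]
    let Bv := rows.map fun ρ => dotL ρ [0, 3, 0]
    let mv := vmin Av Bv
    let Gv := vmin Cv mv
    let M₁ := expOf 3 (vsub Cv Gv)
    let M₂ := expOf 3 (vsub mv Gv)
    let r := expOf 3 (vsub Av mv)
    let s := expOf 3 (vsub Bv mv)
    let Φ : MvPolynomial (Fin 4) k := rename Fin.succ (monomial M₁ (1 : k)) * X 0 - rename Fin.succ (monomial M₂ (1 : k) * (monomial r 1 - monomial s 1))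
    ∀ (c : Fin 3 → k) (w₀ : k) (y : Spec (.of (MvPolynomial (Fin 4) k ⧸ Ideal.span {Φ}))), y.asIdeal.IsMaximal →
      y.asIdeal.comap (Ideal.Quotient.mk (Ideal.span {Φ})) = Ideal.span (Set.range (Fin.cons ((X 0 : MvPolynomial (Fin 4) k) - C w₀) fun i : Fin 3 => X i.succ - C (c i))) →
      FullCl p ((Spec (.of (MvPolynomial (Fin 4) k ⧸ Ideal.span {Φ}))).presheaf.stalk y) :=
  fullCl_pencilChartW_of_checkExits' k p hp5 3 22 2 [2, 0, 0] [0, 3, 0] RAYS_G9 CONES_G9 ORB3 TAGS_G9 cert'_G9 orb3_complete sides_G9.1 sides_G9.2 σ hσ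

/-- ★★★ **Ω₁ LOCAL CURE ROW, Γ₉ (G9), `U`-CHARTS**: the same for every closed point of the `U`-pencil chart over `(u₀; c)`, every `u₀`. [OURS · TASK 4c; cite: Fedder1983, Thm. 1.12] -/
theorem omega1_G9_pencilChartU_fullCl (hp5 : 5 ≤ p) (σ : List ℕ) (hσ : σ ∈ CONES_G9) :
    let rows := raysOf RAYS_G9 σ
    let Cv := rows.map fun ρ => 22 * getL ρ 2 0
    let Av := rows.map fun ρ => dotL ρ [2, 0, 0]
    let Bv := rows.map fun ρ => dotL ρ [0, 3, 0]
    let mv := vmin Av Bv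
    let Gv := vmin Cv mv
    let M₁ := expOf 3 (vsub Cv Gv)
    let M₂ := expOf 3 (vsub mv Gv)
    let r := expOf 3 (vsub Av mv)
    let s := expOf 3 (vsub Bv mv)
    let Φ : MvPolynomial (Fin 4) k := rename Fin.succ (monomial M₂ (1 : k) * (monomial r 1 - monomial s 1)) * X 0 - rename Fin.succ (monomial M₁ (1 : k))
    ∀ (c : Fin 3 → k) (u₀ : k) (y : Spec (.of (MvPolynomial (Fin 4) k ⧸ Ideal.span {Φ}))), y.asIdeal.IsMaximal →
      y.asIdeal.comap (Ideal.Quotient.mk (Ideal.span {Φ})) = Ideal.span (Set.range (Fin.cons ((X 0 : MvPolynomial (Fin 4) k) - C u₀) fun i : Fin 3 => X i.succ - C (c i))) →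
      FullCl p ((Spec (.of (MvPolynomial (Fin 4) k ⧸ Ideal.span {Φ}))).presheaf.stalk y) :=
  fullCl_pencilChartU_of_checkExits' k p hp5 3 22 2 [2, 0, 0] [0, 3, 0] RAYS_G9 CONES_G9 ORB3 TAGS_G9 cert'_G9 orb3_complete sides_G9.1 sides_G9.2 σ hσ

/-- ★★★ **Ω₁ LOCAL CURE ROW, Γ₁₀ generic point (G10: `𝒥 = (c⁴³, u′² − y′³)` on `k[u′,y′,c]`, 35 rays / 65 cones), `W`-CHARTS**, `p ≥ 5`. [OURS · TASK 4c; cite: Fedder1983, Thm. 1.12] -/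
theorem omega1_G10_pencilChartW_fullCl (hp5 : 5 ≤ p) (σ : List ℕ) (hσ : σ ∈ CONES_G10) :
    let rows := raysOf RAYS_G10 σ
    let Cv := rows.map fun ρ => 43 * getL ρ 2 0
    let Av := rows.map fun ρ => dotL ρ [2, 0, 0]
    let Bv := rows.map fun ρ => dotL ρ [0, 3, 0]
    let mv := vmin Av Bv
    let Gv := vmin Cv mv
    let M₁ := expOf 3 (vsub Cv Gv)
    let M₂ := expOf 3 (vsub mv Gv)
    let r := expOf 3 (vsub Av mv)
    let s := expOf 3 (vsub Bv mv)
    let Φ : MvPolynomial (Fin 4) k := rename Fin.succ (monomial M₁ (1 : k)) * X 0 - rename Fin.succ (monomial M₂ (1 : k) * (monomial r 1 - monomial s 1))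
    ∀ (c : Fin 3 → k) (w₀ : k) (y : Spec (.of (MvPolynomial (Fin 4) k ⧸ Ideal.span {Φ}))), y.asIdeal.IsMaximal →
      y.asIdeal.comap (Ideal.Quotient.mk (Ideal.span {Φ})) = Ideal.span (Set.range (Fin.cons ((X 0 : MvPolynomial (Fin 4) k) - C w₀) fun i : Fin 3 => X i.succ - C (c i))) →
      FullCl p ((Spec (.of (MvPolynomial (Fin 4) k ⧸ Ideal.span {Φ}))).presheaf.stalk y) :=
  fullCl_pencilChartW_of_checkExits' k p hp5 3 43 2 [2, 0, 0] [0, 3, 0] RAYS_G10 CONES_G10 ORB3 TAGS_G10 cert'_G10 orb3_complete sides_G10.1 sides_G10.2 σ hσ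

/-- ★★★ **Ω₁ LOCAL CURE ROW, Γ₁₀ generic point (G10), `U`-CHARTS**, every `u₀`, `p ≥ 5`. [OURS · TASK 4c; cite: Fedder1983, Thm. 1.12] -/
theorem omega1_G10_pencilChartU_fullCl (hp5 : 5 ≤ p) (σ : List ℕ) (hσ : σ ∈ CONES_G10) :
    let rows := raysOf RAYS_G10 σ
    let Cv := rows.map fun ρ => 43 * getL ρ 2 0
    let Av := rows.map fun ρ => dotL ρ [2, 0, 0]
    let Bv := rows.map fun ρ => dotL ρ [0, 3, 0]
    let mv := vmin Av Bv
    let Gv := vmin Cv mv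
    let M₁ := expOf 3 (vsub Cv Gv)
    let M₂ := expOf 3 (vsub mv Gv)
    let r := expOf 3 (vsub Av mv)
    let s := expOf 3 (vsub Bv mv)
    let Φ : MvPolynomial (Fin 4) k := rename Fin.succ (monomial M₂ (1 : k) * (monomial r 1 - monomial s 1)) * X 0 - rename Fin.succ (monomial M₁ (1 : k))
    ∀ (c : Fin 3 → k) (u₀ : k) (y : Spec (.of (MvPolynomial (Fin 4) k ⧸ Ideal.span {Φ}))), y.asIdeal.IsMaximal →
      y.asIdeal.comap (Ideal.Quotient.mk (Ideal.span {Φ})) = Ideal.span (Set.range (Fin.cons ((X 0 : MvPolynomial (Fin 4) k) - C u₀) fun i : Fin 3 => X i.succ - C (c i))) →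
      FullCl p ((Spec (.of (MvPolynomial (Fin 4) k ⧸ Ideal.span {Φ}))).presheaf.stalk y) :=
  fullCl_pencilChartU_of_checkExits' k p hp5 3 43 2 [2, 0, 0] [0, 3, 0] RAYS_G10 CONES_G10 ORB3 TAGS_G10 cert'_G10 orb3_complete sides_G10.1 sides_G10.2 σ hσ

/-- ★★★ **Ω₁ LOCAL CURE ROW, Γ₁₀ at `Q*` (G10Q: `𝒥 = (c⁴³, x′u′² − y′³)` on `k[x′,u′,y′,c]`, 36 rays / 65 cones), `W`-CHARTS**, `p ≥ 5`. [OURS · TASK 4c; cite: Fedder1983, Thm. 1.12] -/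
theorem omega1_G10Q_pencilChartW_fullCl (hp5 : 5 ≤ p) (σ : List ℕ) (hσ : σ ∈ CONES_G10Q) :
    let rows := raysOf RAYS_G10Q σ
    let Cv := rows.map fun ρ => 43 * getL ρ 3 0
    let Av := rows.map fun ρ => dotL ρ [1, 2, 0, 0]
    let Bv := rows.map fun ρ => dotL ρ [0, 0, 3, 0]
    let mv := vmin Av Bv
    let Gv := vmin Cv mv
    let M₁ := expOf 4 (vsub Cv Gv)
    let M₂ := expOf 4 (vsub mv Gv)
    let r := expOf 4 (vsub Av mv)
    let s := expOf 4 (vsub Bv mv)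
    let Φ : MvPolynomial (Fin 5) k := rename Fin.succ (monomial M₁ (1 : k)) * X 0 - rename Fin.succ (monomial M₂ (1 : k) * (monomial r 1 - monomial s 1))
    ∀ (c : Fin 4 → k) (w₀ : k) (y : Spec (.of (MvPolynomial (Fin 5) k ⧸ Ideal.span {Φ}))), y.asIdeal.IsMaximal →
      y.asIdeal.comap (Ideal.Quotient.mk (Ideal.span {Φ})) = Ideal.span (Set.range (Fin.cons ((X 0 : MvPolynomial (Fin 5) k) - C w₀) fun i : Fin 4 => X i.succ - C (c i))) →
      FullCl p ((Spec (.of (MvPolynomial (Fin 5) k ⧸ Ideal.span {Φ}))).presheaf.stalk y) :=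
  fullCl_pencilChartW_of_checkExits' k p hp5 4 43 3 [1, 2, 0, 0] [0, 0, 3, 0] RAYS_G10Q CONES_G10Q ORB4 TAGS_G10Q cert'_G10Q orb4_complete sides_G10Q.1 sides_G10Q.2 σ hσ

/-- ★★★ **Ω₁ LOCAL CURE ROW, Γ₁₀ at `Q*` (G10Q), `U`-CHARTS**, every `u₀`, `p ≥ 5`. [OURS · TASK 4c; cite: Fedder1983, Thm. 1.12] -/
theorem omega1_G10Q_pencilChartU_fullCl (hp5 : 5 ≤ p) (σ : List ℕ) (hσ : σ ∈ CONES_G10Q) :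
    let rows := raysOf RAYS_G10Q σ
    let Cv := rows.map fun ρ => 43 * getL ρ 3 0
    let Av := rows.map fun ρ => dotL ρ [1, 2, 0, 0]
    let Bv := rows.map fun ρ => dotL ρ [0, 0, 3, 0]
    let mv := vmin Av Bv
    let Gv := vmin Cv mv
    let M₁ := expOf 4 (vsub Cv Gv)
    let M₂ := expOf 4 (vsub mv Gv)
    let r := expOf 4 (vsub Av mv)
    let s := expOf 4 (vsub Bv mv)
    let Φ : MvPolynomial (Fin 5) k := rename Fin.succ (monomial M₂ (1 : k) * (monomial r 1 - monomial s 1)) * X 0 - rename Fin.succ (monomial M₁ (1 : k))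
    ∀ (c : Fin 4 → k) (u₀ : k) (y : Spec (.of (MvPolynomial (Fin 5) k ⧸ Ideal.span {Φ}))), y.asIdeal.IsMaximal →
      y.asIdeal.comap (Ideal.Quotient.mk (Ideal.span {Φ})) = Ideal.span (Set.range (Fin.cons ((X 0 : MvPolynomial (Fin 5) k) - C u₀) fun i : Fin 4 => X i.succ - C (c i))) →
      FullCl p ((Spec (.of (MvPolynomial (Fin 5) k ⧸ Ideal.span {Φ}))).presheaf.stalk y) :=
  fullCl_pencilChartU_of_checkExits' k p hp5 4 43 3 [1, 2, 0, 0] [0, 0, 3, 0] RAYS_G10Q CONES_G10Q ORB4 TAGS_G10Q cert'_G10Q orb4_complete sides_G10Q.1 sides_G10Q.2 σ hσ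

end Row

end Summit.ResolutionOfSingularities.ResolutionOfSingularities.Theorems.FInjectiveMacaulayfication.OmegaLocalCureRow

end
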